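import Summits.QuantumFields.YangMills.Theorems.BalabanUVNodesN19AtSpineCarriers

/-!
# BalabanUVNodes ∕ N19 (NE7 proper) — THE (F) SPLIT OF THE SYNCHRONISED LEDGER PREDICATE `N19LedgerLinkSync.LedgerAtSync` INTO DISPLAYED PIECES, WITH THE
# FRAME's ONE ESTIMATE `FinestStepModConst` ISOLATED (lens ROW s4′)

Cell `pub-ymgap` (HUMAN RULING D-0062, Track A), R134 ACCELERATION seat `pub-ymgap-dag-n19-d`, gen 4, module 12 = lens ROW s4′ of `ym-lens-BalabanUVNodes-decomp`'s
`LENS-decomp.md` v2 (sha16 9be38b53dab42451, l.78: «owner n19-d … when free»; NODE-TABLE v28∕v29 «FAN-OUT v1.3 §N19 … s4′»).  AUTHORSHIP: the structure `TwoRunFormat` (F1)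
and its projection are LIFTED VERBATIM from the lens seat's sketch `ym-lens-BalabanUVNodes-decomp/lean/LensDecompNE7.sketch.lean` Piece F (planner-ym-lens-BalabanUVNodes-decomp-g0,
2026-08-26; not filed there); the rest follows its written design (v1 §5 s4 + v2 l.78).  Filed `--kind definition --supports` K3′ `SpineGivenEndpointR12` = stmt-QuantumFields-19908
`--as helper`.  COUNT-NEUTRAL.  No Theses import.

WHY.  `LedgerAtSync L l₀ vol T Bad A B R EA EB κ g uA uB ω θc θ₅ θ₃` (dag-n19-a gen 2, p413834 lineage; 37 fields) is the NON-EDGE binder list of the N19 knit chain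
`core_summable_of_ledgerAtSync` — «Link S R»: what a spine record must carry, BEYOND the in-edges N16∕N17∕N18∕N22 and the printed-grade bracket (T), for the two-run matching
`∃ δ, Spine.NE7.Core … δ ∧ Summable δ` to follow.  Read as ONE predicate it passes as bookkeeping; but its fields are of FOUR different species, and exactly ONE group is a two-run
ESTIMATE.  This module partitions the 37 fields into six `Prop`-valued structures with the SAME binders (fields VERBATIM), proves the partition is lossless
(`ledgerAtSync_iff_pieces`), and restates the N19 edge and its reading at the spine carriers with the pieces displayed — so that (i) NODE O ∕ the rate-record home can discharge the
object-bound pieces one by one BY NAME, (ii) the NE7 desk's W-NE7-3 («common fluctuation measure of the two runs») becomes a statement about `TwoRunFormat` ALONE, and (iii) no referee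
books `FinestStepModConst` as bookkeeping:
* F1 `TwoRunFormat` — `fmtA fmtB int off`: both runs' good-term cores are integrals against the SAME fluctuation measure over the SAME variable space with E-factor products over the
  SAME (2.25)-ledger (run B's couplings shifted `i ↦ g (K+1) (i+1)`, run B's first step inside `oB`), integrable, vanishing off NE3's admissible data.  An UNPRINTED two-run
  REPRESENTATION statement (object-bound, NODE O); no estimate.
* F2 `LedgerBooking` — `all_sub all_sc all_mult Cl_nonneg recent`: the τ-free reference ledger with the (0.26) multiplicity and the booking of the good class on the log window.
  Object-bound bookkeeping (n19-a's `…MultiplicityByName` supplies (0.26) by name).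
* F3 `LedgerOtherKinds` — `ofmtA ofmtB u5b CO_nonneg wO_nonneg orec omult cf_le Cs_nonneg posO`: the other kinds FACTORED as extracted constants × main-action readings × the recent
  node-U5b ledger × the remaining kinds, positive.  Object-bound (node U5b's format).
* F3′ `FinestStepModConst` — `other RO_le rO_summable cO_dev`: **THE FRAME's ONE ESTIMATE** (lens Q3 ∕ NE7 desk W-NE7-3): the remaining kinds' two-run log-ratio — where run B's
  UNPARTNERED FINEST step is booked — is, on every good class, within `RO″ ≤ vol·rO″` (summable) of a class-constant `cO″` which itself deviates from a `t,τ`-free constant by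
  `vol·s_K` (summable).  A two-run MATCHING statement modulo constants at the finest scale — NOT PRINTED ([B12]–[B16] treat one run), NOT proved; to be routed by NODE O (N19-resident
  vs N22's 𝐑-operation).
* S `LedgerSize` — `size sizeProfile E₀_nonneg a_pos a_lt_one`: the zero-centred one-run size in the (2.43) log-window profile (its instance is n19-a's `…N19SizeByName` road,
  [III] Thm 2 (2.43) as printed + N14).
* C `LedgerConventions` — `one rvol vol_nonneg` + the rate ordering `rate_gt θ₅_le θ₃_le rate_lt_one rate_le_base one_le_base`: letters and conventions, no content.

WHAT IS KERNEL-CHECKED ([bookkeeping], definitional): the six projections `LedgerAtSync.twoRunFormat ∕ .booking ∕ .otherKinds ∕ .finestStep ∕ .size ∕ .conventions`, the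
reassembly `ledgerAtSync_of_pieces`, `ledgerAtSync_iff_pieces`, the N19 edge with the pieces displayed `core_summable_of_ledgerPieces` (= `core_summable_of_ledgerAtSync`), the
reading at the spine carriers with the pieces displayed `s_N19_of_ledgerPiecesReading` (= `N19AtSpineCarriers.s_N19_of_ledgerAtSyncReading`), and non-vacuity of the estimate piece
`finestStepModConst_nonvacuous` (projection of `N19LedgerLinkSync.ledgerAtSync_toy`).

HONEST FRAMING.  Definitional re-bundling; every piece is a HYPOTHESIS SHAPE about Bałaban's two-run (2.18)∕(2.25) ledger at the carriers of record (cell NODE O; no tree object reads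
it today); `FinestStepModConst` is an unprinted two-run estimate DISPLAYED, not proved; nothing of Bałaban's is asserted; NE7 ∕ NE7b ∕ NE7c NOT PRINTED for d = 4 and NOT PROVED;
NO node is discharged; K3′ NOT claimed; counts UNMOVED (typed 28∕28 · discharged 5∕27, A 5∕28); one finite four-torus programme at fixed `ε = L^{−K}` — NOT ℝ⁴, NOT infinite volume,
NOT OS, NOT a mass gap, NOT Clay.  0 `sorry`; no decl below carries a cite tag.
-/

open Finset MeasureTheory

namespace Summit.QuantumFields.YangMills.BalabanUVNodes.N19LedgerPieces

open Literature.MathematicalPhysics.QuantumFieldTheory.Balaban1983to89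
open T4OutputRate T4RecentScale T4GoodClassBudget T4CauchySum T4TowerRateComposition T4TowerRateDischarge
open T4EtaRateMin (Readings NE3Shape)
open T4RateLiaison (GaugeDominated)
open Summit.QuantumFields.BalabanUV.T4Continuum.Spine
open Summit.QuantumFields.YangMills.BalabanUVNodes.N19LedgerLinkSync (LedgerDataSync LedgerAtSync core_summable_of_ledgerAtSync ledgerAtSync_toy)
open Summit.QuantumFields.YangMills.BalabanUVNodes.N19AtSpineCarriers (deltaOfRecord s_N19_of_coreEdge)
open YMDAG.UVSplit (SpineCarriers SpineRecordPred InputsPred S_N19)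

/-! ## §1 The six pieces (fields of `LedgerAtSync` VERBATIM, same binders) -/

section Pieces

variable {C : Carriers} [DecidableEq C.Dom] {F : Type*} {ι X : Type} [MeasurableSpace ι] {σ : Type*} [DecidableEq σ]

/-- **F1 «TWO-RUN FORMAT»** (lens Piece F1, verbatim) — the four synchronisation fields of `LedgerAtSync` ALONE: both runs' good-term cores are integrals against the SAME fluctuation
measure `μ K t τ` over the SAME variable space, with E-factor products over the SAME (2.25)-ledger `fac K t τ` (run B's couplings shifted `i ↦ g (K+1) (i+1)`, run B's first step
inside `oB`), integrable, and vanishing off NE3's admissible data `R.dom`.  An UNPRINTED two-run REPRESENTATION statement (W-NE7-3 «common μ»); object-bound (NODE O); no estimate.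
[shape] -/
structure TwoRunFormat (L : LedgerDataSync C F ι σ) (l₀ : ℝ) (T : ℕ → Finset σ) (Bad : ℕ → ℝ → Finset σ) (A B : ℕ → ℝ → σ → ℝ) (R : Readings ι X)
    (EA : Functional C C.BgA) (EB : Functional C C.BgB) (g : ℕ → ℕ → ℝ) (uA : ℕ → ι → C.BgA) (uB : ℕ → ι → C.BgB) : Prop where
  fmtA : ∀ K t τ, A K t τ = ∫ v, (∏ X ∈ L.fac K t τ,
    Real.exp (EA (g K) (uA K v) X - EA (g K) L.oneA X)) * L.oA K t τ v ∂(L.μ K t τ)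
  fmtB : ∀ K t τ, B K t τ = ∫ v, (∏ X ∈ L.fac K t τ,
    Real.exp (EB (fun i => g (K + 1) (i + 1)) (uB K v) X - EB (fun i => g (K + 1) (i + 1)) L.oneB X)) *
      L.oB K t τ v ∂(L.μ K t τ)
  int : ∀ K t, |t| ≤ l₀ → ∀ τ ∈ T K \ Bad K t,
    Integrable (fun v => (∏ X ∈ L.fac K t τ, Real.exp (EA (g K) (uA K v) X - EA (g K) L.oneA X)) *
      L.oA K t τ v) (L.μ K t τ) ∧
    Integrable (fun v => (∏ X ∈ L.fac K t τ,
      Real.exp (EB (fun i => g (K + 1) (i + 1)) (uB K v) X - EB (fun i => g (K + 1) (i + 1)) L.oneB X)) *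
      L.oB K t τ v) (L.μ K t τ)
  off : ∀ K t, |t| ≤ l₀ → ∀ τ ∈ T K \ Bad K t, ∀ v, v ∉ R.dom →
    (∏ X ∈ L.fac K t τ, Real.exp (EA (g K) (uA K v) X - EA (g K) L.oneA X)) * L.oA K t τ v = 0 ∧
    (∏ X ∈ L.fac K t τ,
      Real.exp (EB (fun i => g (K + 1) (i + 1)) (uB K v) X - EB (fun i => g (K + 1) (i + 1)) L.oneB X)) *
      L.oB K t τ v = 0

/-- **F2 «BOOKING»** — the τ-free REFERENCE LEDGER and the booking of the good class: every E-factor domain of a good term lies in the reference ledger of its cutoff, whose domains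
have scale `≤ K` and obey the (0.26) multiplicity with letters `Cw`, `Λg` at decay `κ`; `0 ≤ Cl`; the domains OUTSIDE the term's ledger are RECENT on the log window `jlogOf Cl K`.
Object-bound bookkeeping; no estimate beyond (0.26) (supplied by name, n19-a `…N19MultiplicityByName`). [shape] -/
structure LedgerBooking (L : LedgerDataSync C F ι σ) (l₀ vol : ℝ) (T : ℕ → Finset σ) (Bad : ℕ → ℝ → Finset σ) (κ : ℝ) : Prop where
  all_sub : ∀ K t, |t| ≤ l₀ → ∀ τ ∈ T K \ Bad K t, L.fac K t τ ⊆ L.All K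
  all_sc : ∀ K, ∀ X ∈ L.All K, C.scale X ≤ K
  all_mult : ∀ K, Multiplicity (L.All K) C.scale (fun X => Real.exp (-(κ * C.d X))) L.Cw vol L.Λg K
  Cl_nonneg : 0 ≤ L.Cl
  recent : ∀ K t, |t| ≤ l₀ → ∀ τ ∈ T K \ Bad K t, RecentOnly (L.All K \ L.fac K t τ) C.scale (jlogOf L.Cl K) K

/-- **F3 «OTHER KINDS, FACTORED»** — the full other kinds `oA`, `oB` ARE extracted constants × main-action readings × the recent node-U5b ledger of boundary ∕ 𝐑 ∕ insert ∕ pending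
factors (with `T4RecentScale.FactorLogRatio` at kind constant `CO ≥ 0`, weights `wO ≥ 0`, recent scales, window multiplicity, extracted constants `|cf| ≤ Cs·θ′^{sc}·wO`, `Cs ≥ 0`)
× the remaining kinds `oA″`, `oB″`, POSITIVE on `R.dom`.  Object-bound (node U5b's format); no two-run estimate. [shape] -/
structure LedgerOtherKinds (L : LedgerDataSync C F ι σ) (l₀ vol : ℝ) (T : ℕ → Finset σ) (Bad : ℕ → ℝ → Finset σ) (R : Readings ι X)
    (EA : Functional C C.BgA) (EB : Functional C C.BgB) (g : ℕ → ℕ → ℝ) : Prop where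
  ofmtA : ∀ K t τ v, L.oA K t τ v = Real.exp (∑ X ∈ L.fac K t τ, EA (g K) L.oneA X) *
    (Real.exp (-(R.act K v)) * ((∏ i ∈ L.facO K t τ, L.ofA K t τ i v) * L.oA'' K t τ v))
  ofmtB : ∀ K t τ v, L.oB K t τ v = Real.exp (∑ X ∈ L.fac K t τ, EB (fun i => g (K + 1) (i + 1)) L.oneB X) *
    (Real.exp (-(R.act (K + 1) v)) * ((∏ i ∈ L.facO K t τ, L.ofB K t τ i v) * L.oB'' K t τ v))
  u5b : ∀ K t, |t| ≤ l₀ → ∀ τ ∈ T K \ Bad K t,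
    FactorLogRatio R.dom (L.facO K t τ) L.kindO L.scO L.wO (L.ofA K t τ) (L.ofB K t τ) (L.cf K t τ)
      (fun _ => L.CO) L.θ' (fun _ => 0)
  CO_nonneg : 0 ≤ L.CO
  wO_nonneg : ∀ i, 0 ≤ L.wO i
  orec : ∀ K t, |t| ≤ l₀ → ∀ τ ∈ T K \ Bad K t, RecentOnly (L.facO K t τ) L.scO (jlogOf L.Cl K) K
  omult : ∀ K t, |t| ≤ l₀ → ∀ τ ∈ T K \ Bad K t,
    WindowMultiplicity (L.facO K t τ) L.scO L.wO L.Cw vol L.Λg (jlogOf L.Cl K) K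
  cf_le : ∀ K t, |t| ≤ l₀ → ∀ τ ∈ T K \ Bad K t, ∀ i ∈ L.facO K t τ, |L.cf K t τ i| ≤ L.Cs * L.θ' ^ L.scO i * L.wO i
  Cs_nonneg : 0 ≤ L.Cs
  posO : ∀ K t, |t| ≤ l₀ → ∀ τ ∈ T K \ Bad K t, ∀ v ∈ R.dom, 0 < L.oA'' K t τ v ∧ 0 < L.oB'' K t τ v

/-- **F3′ «THE FINEST STEP MATCHES A CONSTANT» — THE FRAME's ONE ESTIMATE** (lens Q3 ∕ NE7 desk W-NE7-3): on every good class, for every admissible datum `v ∈ R.dom`, the two-run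
log-ratio of the REMAINING kinds — where run B's UNPARTNERED FINEST step is booked (`ofmtB` shifts run B's table, so its finest scale has no run-A partner) — is within `RO″ K t τ` of a
`v`-free class constant `cO″ K t τ`, with `RO″ ≤ vol·rO″_K`, `rO″` SUMMABLE, and the class constants deviate from `t,τ`-free constants `c₀ K` by `vol·s_K`, `s` SUMMABLE.  A two-run
MATCHING statement modulo constants at the finest scale: NOT PRINTED ([B12]–[B16] treat one run), NOT proved here; to be routed by NODE O (N19-resident vs N22's 𝐑-operation). [shape] -/
structure FinestStepModConst (L : LedgerDataSync C F ι σ) (l₀ vol : ℝ) (T : ℕ → Finset σ) (Bad : ℕ → ℝ → Finset σ) (R : Readings ι X) : Prop where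
  other : ∀ K t, |t| ≤ l₀ → ∀ τ ∈ T K \ Bad K t, ∀ v ∈ R.dom,
    |Real.log (L.oB'' K t τ v) - Real.log (L.oA'' K t τ v) - L.cO'' K t τ| ≤ L.RO'' K t τ
  RO_le : ∀ K t, |t| ≤ l₀ → ∀ τ ∈ T K \ Bad K t, L.RO'' K t τ ≤ vol * L.rO'' K
  rO_summable : Summable L.rO''
  cO_dev : ∃ c₀ s : ℕ → ℝ, Summable s ∧ ∀ K t, |t| ≤ l₀ → ∀ τ ∈ T K \ Bad K t, |L.cO'' K t τ - c₀ K| ≤ vol * s K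

/-- **S «SIZE»** — the ZERO-CENTRED one-run size of the two-run log-ratio per creation-scale slice, `|Σ_{scale X = j} (…)| ≤ S K t τ j`, in the (2.43) log-window profile
`S ≤ vol·E₀·(K+1)^m·a^{K−j}` with `0 ≤ E₀`, `0 < a < 1`.  Printed-grade per run ([III] Thm 2 (2.43) + N14's pinned pair, n19-a `…N19SizeByName`); the two-run bundling is the
convention. [shape] -/
structure LedgerSize (L : LedgerDataSync C F ι σ) (l₀ vol : ℝ) (T : ℕ → Finset σ) (Bad : ℕ → ℝ → Finset σ) (R : Readings ι X)
    (EA : Functional C C.BgA) (EB : Functional C C.BgB) (g : ℕ → ℕ → ℝ) (uA : ℕ → ι → C.BgA) (uB : ℕ → ι → C.BgB) : Prop where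
  size : ∀ K t, |t| ≤ l₀ → ∀ τ ∈ T K \ Bad K t, ∀ v ∈ R.dom, ∀ j ≤ K,
    |∑ X ∈ L.fac K t τ with C.scale X = j,
        (Real.log (Real.exp (EB (fun i => g (K + 1) (i + 1)) (uB K v) X
            - EB (fun i => g (K + 1) (i + 1)) L.oneB X))
          - Real.log (Real.exp (EA (g K) (uA K v) X - EA (g K) L.oneA X)))| ≤ L.S K t τ j
  sizeProfile : ∀ K t, |t| ≤ l₀ → ∀ τ ∈ T K \ Bad K t, ∀ j ≤ K,
    L.S K t τ j ≤ vol * (L.E₀ * ((K : ℝ) + 1) ^ L.m * L.a ^ (K - j))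
  E₀_nonneg : 0 ≤ L.E₀
  a_pos : 0 < L.a
  a_lt_one : L.a < 1

/-- **C «CONVENTIONS»** — `C.transport oneB = oneA`, `R.vol ≤ vol`, `0 ≤ vol`, and the RATE ORDERING `max ω θc < θ′`, `θ₅, θ₃ ≤ θ′ < 1`, `θ′ ≤ Λg`, `1 ≤ Λg`.  Letters; no content.
[shape] -/
structure LedgerConventions (L : LedgerDataSync C F ι σ) (vol : ℝ) (R : Readings ι X) (ω θc θ₅ θ₃ : ℝ) : Prop where
  one : C.transport L.oneB = L.oneA
  rvol : R.vol ≤ vol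
  vol_nonneg : 0 ≤ vol
  rate_gt : max ω θc < L.θ'
  θ₅_le : θ₅ ≤ L.θ'
  θ₃_le : θ₃ ≤ L.θ'
  rate_lt_one : L.θ' < 1
  rate_le_base : L.θ' ≤ L.Λg
  one_le_base : 1 ≤ L.Λg

end Pieces

/-! ## §2 The partition is lossless: projections and reassembly -/

section Split

variable {C : Carriers} [DecidableEq C.Dom] {F : Type*} {ι X : Type} [MeasurableSpace ι] {σ : Type*} [DecidableEq σ]
  {L : LedgerDataSync C F ι σ} {l₀ vol : ℝ} {T : ℕ → Finset σ} {Bad : ℕ → ℝ → Finset σ} {A B : ℕ → ℝ → σ → ℝ}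
  {R : Readings ι X} {EA : Functional C C.BgA} {EB : Functional C C.BgB} {κ : ℝ} {g : ℕ → ℕ → ℝ}
  {uA : ℕ → ι → C.BgA} {uB : ℕ → ι → C.BgB} {ω θc θ₅ θ₃ : ℝ}

/-- F1 is a projection of the synchronised ledger predicate (lens Piece F1's `twoRunFormat_of_ledgerAtSync`, verbatim). [bookkeeping] -/
theorem _root_.Summit.QuantumFields.YangMills.BalabanUVNodes.N19LedgerLinkSync.LedgerAtSync.twoRunFormat
    (h : LedgerAtSync L l₀ vol T Bad A B R EA EB κ g uA uB ω θc θ₅ θ₃) : TwoRunFormat L l₀ T Bad A B R EA EB g uA uB :=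
  ⟨h.fmtA, h.fmtB, h.int, h.off⟩

/-- F2 is a projection. [bookkeeping] -/
theorem _root_.Summit.QuantumFields.YangMills.BalabanUVNodes.N19LedgerLinkSync.LedgerAtSync.booking
    (h : LedgerAtSync L l₀ vol T Bad A B R EA EB κ g uA uB ω θc θ₅ θ₃) : LedgerBooking L l₀ vol T Bad κ :=
  ⟨h.all_sub, h.all_sc, h.all_mult, h.Cl_nonneg, h.recent⟩

/-- F3 is a projection. [bookkeeping] -/
theorem _root_.Summit.QuantumFields.YangMills.BalabanUVNodes.N19LedgerLinkSync.LedgerAtSync.otherKinds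
    (h : LedgerAtSync L l₀ vol T Bad A B R EA EB κ g uA uB ω θc θ₅ θ₃) : LedgerOtherKinds L l₀ vol T Bad R EA EB g :=
  ⟨h.ofmtA, h.ofmtB, h.u5b, h.CO_nonneg, h.wO_nonneg, h.orec, h.omult, h.cf_le, h.Cs_nonneg, h.posO⟩

/-- **F3′ — the estimate — is a projection**: every synchronised ledger of record CARRIES the finest-step matching. [bookkeeping] -/
theorem _root_.Summit.QuantumFields.YangMills.BalabanUVNodes.N19LedgerLinkSync.LedgerAtSync.finestStep
    (h : LedgerAtSync L l₀ vol T Bad A B R EA EB κ g uA uB ω θc θ₅ θ₃) : FinestStepModConst L l₀ vol T Bad R :=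
  ⟨h.other, h.RO_le, h.rO_summable, h.cO_dev⟩

/-- S is a projection. [bookkeeping] -/
theorem _root_.Summit.QuantumFields.YangMills.BalabanUVNodes.N19LedgerLinkSync.LedgerAtSync.size'
    (h : LedgerAtSync L l₀ vol T Bad A B R EA EB κ g uA uB ω θc θ₅ θ₃) : LedgerSize L l₀ vol T Bad R EA EB g uA uB :=
  ⟨h.size, h.sizeProfile, h.E₀_nonneg, h.a_pos, h.a_lt_one⟩

/-- C is a projection. [bookkeeping] -/
theorem _root_.Summit.QuantumFields.YangMills.BalabanUVNodes.N19LedgerLinkSync.LedgerAtSync.conventions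
    (h : LedgerAtSync L l₀ vol T Bad A B R EA EB κ g uA uB ω θc θ₅ θ₃) : LedgerConventions L vol R ω θc θ₅ θ₃ :=
  ⟨h.one, h.rvol, h.vol_nonneg, h.rate_gt, h.θ₅_le, h.θ₃_le, h.rate_lt_one, h.rate_le_base, h.one_le_base⟩

/-- **REASSEMBLY**: the six pieces give back the synchronised ledger predicate, field by field. [bookkeeping] -/
theorem ledgerAtSync_of_pieces (hF : TwoRunFormat L l₀ T Bad A B R EA EB g uA uB) (hB : LedgerBooking L l₀ vol T Bad κ)
    (hO : LedgerOtherKinds L l₀ vol T Bad R EA EB g) (hQ : FinestStepModConst L l₀ vol T Bad R) (hS : LedgerSize L l₀ vol T Bad R EA EB g uA uB)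
    (hC : LedgerConventions L vol R ω θc θ₅ θ₃) : LedgerAtSync L l₀ vol T Bad A B R EA EB κ g uA uB ω θc θ₅ θ₃ where
  fmtA := hF.fmtA
  fmtB := hF.fmtB
  int := hF.int
  off := hF.off
  all_sub := hB.all_sub
  all_sc := hB.all_sc
  all_mult := hB.all_mult
  Cl_nonneg := hB.Cl_nonneg
  recent := hB.recent
  ofmtA := hO.ofmtA
  ofmtB := hO.ofmtB
  u5b := hO.u5b
  CO_nonneg := hO.CO_nonneg
  wO_nonneg := hO.wO_nonneg
  orec := hO.orec
  omult := hO.omult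
  cf_le := hO.cf_le
  Cs_nonneg := hO.Cs_nonneg
  posO := hO.posO
  rvol := hC.rvol
  size := hS.size
  vol_nonneg := hC.vol_nonneg
  E₀_nonneg := hS.E₀_nonneg
  a_pos := hS.a_pos
  a_lt_one := hS.a_lt_one
  sizeProfile := hS.sizeProfile
  other := hQ.other
  RO_le := hQ.RO_le
  rO_summable := hQ.rO_summable
  one := hC.one
  cO_dev := hQ.cO_dev
  rate_gt := hC.rate_gt
  θ₅_le := hC.θ₅_le
  θ₃_le := hC.θ₃_le
  rate_lt_one := hC.rate_lt_one
  rate_le_base := hC.rate_le_base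
  one_le_base := hC.one_le_base

/-- **THE PARTITION IS LOSSLESS**: `LedgerAtSync` ⟺ F1 ∧ F2 ∧ F3 ∧ F3′ ∧ S ∧ C. [bookkeeping] -/
theorem ledgerAtSync_iff_pieces :
    LedgerAtSync L l₀ vol T Bad A B R EA EB κ g uA uB ω θc θ₅ θ₃ ↔
      TwoRunFormat L l₀ T Bad A B R EA EB g uA uB ∧ LedgerBooking L l₀ vol T Bad κ ∧ LedgerOtherKinds L l₀ vol T Bad R EA EB g ∧
        FinestStepModConst L l₀ vol T Bad R ∧ LedgerSize L l₀ vol T Bad R EA EB g uA uB ∧ LedgerConventions L vol R ω θc θ₅ θ₃ :=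
  ⟨fun h => ⟨h.twoRunFormat, h.booking, h.otherKinds, h.finestStep, h.size', h.conventions⟩,
    fun ⟨hF, hB, hO, hQ, hS, hC⟩ => ledgerAtSync_of_pieces hF hB hO hQ hS hC⟩

end Split

/-! ## §3 The N19 edge and its reading at the spine carriers, with the six pieces DISPLAYED in place of `LedgerAtSync` -/

section Edge

variable {C : Carriers} [DecidableEq C.Dom] {F : Type*} {ι X : Type} [MeasurableSpace ι] {σ : Type*} [DecidableEq σ]
  {L : LedgerDataSync C F ι σ} {l₀ vol : ℝ} {T : ℕ → Finset σ} {Bad : ℕ → ℝ → Finset σ} {A B : ℕ → ℝ → σ → ℝ}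
  {R : Readings ι X} {W : Set (ℕ → ℝ)} {EA : Functional C C.BgA} {EB : Functional C C.BgB}
  {κ θ₅ C₅ C₉ ω θc Cd γ C₃ θ₃ Pg : ℝ} {q : ℕ} {Λm : ℕ → ℕ → ℝ} {CU : (ℕ → ℝ) → ℕ → ℝ}
  {g : ℕ → ℕ → ℝ} {uA : ℕ → ι → C.BgA} {uB : ℕ → ι → C.BgB}

/-- **THE N19 EDGE FROM THE SIX PIECES AND THE IN-EDGES** (`N19LedgerLinkSync.core_summable_of_ledgerAtSync` with `LedgerAtSync` replaced by its partition): F1 two-run format · F2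
booking · F3 other kinds factored · F3′ THE FINEST-STEP MATCHING · S size · C conventions, plus N16 = `NE3Shape` with the liaison `GaugeDominated`, N18 = `NE5`, N22 =
`NE9 ∧ FadingMemory`, N17 through node U2's OUTPUT `InjectedRate`, the printed box, the bracket (T) `LipBackground` + `PolyLipGrowth`, both runs' re-indexed couplings in the window
⇒ `∃ δ, Spine.NE7.Core l₀ vol T Bad A B δ ∧ Summable δ`.  CONDITIONAL on every binder; NOT NE7. [bookkeeping] -/
theorem core_summable_of_ledgerPieces (hF : TwoRunFormat L l₀ T Bad A B R EA EB g uA uB) (hB : LedgerBooking L l₀ vol T Bad κ)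
    (hO : LedgerOtherKinds L l₀ vol T Bad R EA EB g) (hQ : FinestStepModConst L l₀ vol T Bad R) (hS : LedgerSize L l₀ vol T Bad R EA EB g uA uB)
    (hC : LedgerConventions L vol R ω θc θ₅ θ₃)
    (h16 : NE3Shape R C₃ θ₃) (hC₃ : 0 ≤ C₃) (hgd : GaugeDominated R uA uB)
    (h18 : NE5 EA EB W κ θ₅ C₅) (hθ₅ : 0 ≤ θ₅) (hC₅ : 0 ≤ C₅)
    (h22 : NE9 EA W κ Λm ∧ T4OutputRate.FadingMemory C₉ ω Λm) (hω : 0 ≤ ω)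
    (hinj : InjectedRate Cd 0 θc (fun K j => T4CouplingMatching.disc (g K) (g (K + 1)) j)) (hCd : 0 ≤ Cd)
    (hθc : 0 ≤ θc) (hbox : ∀ K i, i ≤ K → 0 < g K i ∧ g K i ≤ γ)
    (hU : LipBackground EA W κ CU) (hG : PolyLipGrowth CU g Pg q) (hPg : 0 ≤ Pg)
    (hgA : ∀ K, g K ∈ W) (hgB : ∀ K, (fun i => g (K + 1) (i + 1)) ∈ W) :
    ∃ δ : ℕ → ℝ, NE7.Core l₀ vol T Bad A B δ ∧ Summable δ :=
  core_summable_of_ledgerAtSync (ledgerAtSync_of_pieces hF hB hO hQ hS hC) h16 hC₃ hgd h18 hθ₅ hC₅ h22 hω hinj hCd hθc hbox hU hG hPg hgA hgB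

end Edge

section Reading

variable {N : ℕ} [NeZero N]

/-- **`S_N19` FROM A SIX-PIECE LEDGER READING** (`N19AtSpineCarriers.s_N19_of_ledgerAtSyncReading` with `LedgerAtSync` replaced by its partition; under the `deltaOfRecord` pin of
record): if the carriers of record and K4's inputs hand, for every bundle, ledger data with F1 · F2 · F3 · F3′ (THE FINEST-STEP MATCHING — the one two-run estimate in the list) · S ·
C together with the in-edge letters, then `YMDAG.UVSplit.S_N19 SRec Inputs`.  `SRec`, `Inputs` PARAMETERS; every conjunct a HYPOTHESIS; NOT NE7. [bookkeeping] -/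
theorem s_N19_of_ledgerPiecesReading (SRec : SpineRecordPred N) (Inputs : InputsPred N)
    (hpin : ∀ (F : T4Continuum.T4Family) (D : YMDAG.UVSplit.Datum F N) (g₀ : ℕ → ℝ) (os : List (T4Continuum.ULoop F))
      (S : SpineCarriers), SRec F D g₀ os S → letI := S.dec
      S.δ = deltaOfRecord S.l₀ S.vol S.T S.Bad (fun K t τ => S.A K t τ - S.shA K t τ) (fun K t τ => S.B K t τ - S.shB K t τ))
    (hread : ∀ (F : T4Continuum.T4Family) (D : YMDAG.UVSplit.Datum F N) (g₀ : ℕ → ℝ) (os : List (T4Continuum.ULoop F))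
      (S : SpineCarriers), SRec F D g₀ os S → Inputs F D g₀ os → letI := S.dec
      ∃ (C : Carriers) (_ : DecidableEq C.Dom) (F' : Type) (ι' X' : Type) (_ : MeasurableSpace ι')
        (L : LedgerDataSync C F' ι' S.ι) (R : Readings ι' X') (W : Set (ℕ → ℝ)) (EA : Functional C C.BgA)
        (EB : Functional C C.BgB) (κ θ₅ C₅ C₉ ω θc Cd γ C₃ θ₃ Pg : ℝ) (q : ℕ) (Λm : ℕ → ℕ → ℝ)
        (CU : (ℕ → ℝ) → ℕ → ℝ) (g : ℕ → ℕ → ℝ) (uA : ℕ → ι' → C.BgA) (uB : ℕ → ι' → C.BgB),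
        (TwoRunFormat L S.l₀ S.T S.Bad (fun K t τ => S.A K t τ - S.shA K t τ) (fun K t τ => S.B K t τ - S.shB K t τ) R EA EB g uA uB ∧
          LedgerBooking L S.l₀ S.vol S.T S.Bad κ ∧ LedgerOtherKinds L S.l₀ S.vol S.T S.Bad R EA EB g ∧
          FinestStepModConst L S.l₀ S.vol S.T S.Bad R ∧
          LedgerSize L S.l₀ S.vol S.T S.Bad R EA EB g uA uB ∧ LedgerConventions L S.vol R ω θc θ₅ θ₃) ∧
        NE3Shape R C₃ θ₃ ∧ 0 ≤ C₃ ∧ GaugeDominated R uA uB ∧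
        NE5 EA EB W κ θ₅ C₅ ∧ 0 ≤ θ₅ ∧ 0 ≤ C₅ ∧
        (NE9 EA W κ Λm ∧ T4OutputRate.FadingMemory C₉ ω Λm) ∧ 0 ≤ ω ∧
        InjectedRate Cd 0 θc (fun K j => T4CouplingMatching.disc (g K) (g (K + 1)) j) ∧ 0 ≤ Cd ∧ 0 ≤ θc ∧
        (∀ K i, i ≤ K → 0 < g K i ∧ g K i ≤ γ) ∧
        LipBackground EA W κ CU ∧ PolyLipGrowth CU g Pg q ∧ 0 ≤ Pg ∧
        (∀ K, g K ∈ W) ∧ (∀ K, (fun i => g (K + 1) (i + 1)) ∈ W)) :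
    S_N19 SRec Inputs := by
  refine s_N19_of_coreEdge SRec Inputs hpin fun F D g₀ os S hS hI => ?_
  letI := S.dec
  obtain ⟨C, _, F', ι', X', _, L, R, W, EA, EB, κ, θ₅, C₅, C₉, ω, θc, Cd, γ, C₃, θ₃, Pg, q, Λm, CU, g, uA, uB, ⟨hF, hB, hO, hQ, hSz, hC⟩,
    h16, hC₃, hgd, h18, hθ₅, hC₅, h22, hω, hinj, hCd, hθc, hbox, hU, hG, hPg, hgA, hgB⟩ := hread F D g₀ os S hS hI
  exact core_summable_of_ledgerPieces hF hB hO hQ hSz hC h16 hC₃ hgd h18 hθ₅ hC₅ h22 hω hinj hCd hθc hbox hU hG hPg hgA hgB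

end Reading

/-! ## §4 Non-vacuity of the estimate piece (projection of `N19LedgerLinkSync.ledgerAtSync_toy`) -/

/-- **`FinestStepModConst` IS INHABITED, NON-DEGENERATELY** (the toy synchronised ledger of `ledgerAtSync_toy` at `q = 1∕2`: remaining kinds `e^{−Σ E(·;0)}`, exact class constants,
zero radii): the estimate piece, like the whole predicate, carries no located contradiction. [bookkeeping] -/
theorem finestStepModConst_nonvacuous :
    ∃ (L : LedgerDataSync toyCarriers ℕ Unit Unit) (R : Readings Unit Unit), FinestStepModConst L 1 1 (fun _ => Finset.univ) (fun _ _ => ∅) R :=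
  ⟨_, _, (ledgerAtSync_toy (q := 1 / 2) (γ := 1) (C₅ := 1) (by norm_num) (by norm_num)).finestStep⟩

end Summit.QuantumFields.YangMills.BalabanUVNodes.N19LedgerPieces
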